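import Mathlib
import Summits.Ventures.HodgeRepro.Tier4.Common.AdelicRTF

/-!
# Tier4/Common/MixedPlane — the planes of the face as `PlaneData`: the Gram / `E′`-structure matrices of a hermitian
line `⟨a⟩` over `E′ = k(ω)`, the plane `⟨a⟩ ⊕ ⟨ε b⟩` (`ε = 1`: the seesaw plane `W_a ⊕ W_b`; `ε = −1`: the MIXED plane
`W_a ⊕ W_b⁻` of line L4), and the automorphic-subspace / non-zero-toric-period vocabulary (t4-plan-4's V2 ask, S12168)

Blind re-derivation cell `pub-hodge-repro`, Tier 4 (README §9–§10), seat t4-typer-2 (gen 0).  Target tree path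
`lean/Summits/Ventures/HodgeRepro/Tier4/Common/MixedPlane.lean`.  Imports `Tier4/Common/AdelicRTF.lean` (hence
`AdelicDefs`: `PlaneData`, `GA`, `torusT`, `rationalPoints`, `RTFData`, `periodLin`).

THE `k`-STRUCTURE OF A LINE.  `E′ = k(ω)` with `ω² = t ω − n` (`QuadData k`: `t, n ∈ k`; the CM conjugation is
`c(ω) = t − ω`); in the `k`-basis `(1, ω)` of `E′` the hermitian line `⟨a⟩` (`a ∈ k`: the form `a x c(y)`) has the
trace form `Tr_{E′/k}(a x c(y)) = a (2 x₁ y₁ + t x₁ y₂ + t x₂ y₁ + 2 n x₂ y₂)`, Gram matrix `lineGram q a = a • !![2, t;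
t, 2n]` (symmetric), and the `E′`-structure is `omegaMat q = !![0, −n; 1, t]` (multiplication by `ω`; it commutes with
the Gram matrix in the sense `Ωᵀ G = G Ω′`… — not needed here: the `PlaneData` identities only ask the lines to be
`E′`-subspaces, i.e. the projectors to commute with `Ω`).  **`PlaneData.ofLines q a b ε`** is the plane
`⟨a⟩ ⊕ ⟨ε b⟩` = `k⁴ = k² ⊕ k²` with `B = blockDiag (lineGram a) (ε • lineGram b)`, `Ω = blockDiag ω ω`, the two
projectors `P 0 = diag (1, 0)`, `P 1 = diag (0, 1)` of the torus `U(⟨a⟩) × U(⟨ε b⟩)` and `Q := P` (one torus per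
plane; the second torus of the seesaw lives on the SECOND plane `U′`).  All seven `PlaneData` identities are PROVED
(`fromBlocks` algebra transported along `finSumFinEquiv : Fin 2 ⊕ Fin 2 ≃ Fin 4` by `reindexAlgEquiv`).

THE SIGNS (plan-4's (A)).  The Adelic v0.4 datum carries NO archimedean sign: it is the `k`-rational structure
only.  At a real place `σ` of `k`, the line `⟨a⟩` is positive iff `σ(a) > 0` (the cell's `Lit.posAt`, LitSeesaw
p337500); so `⟨a⟩ ⊕ ⟨−b⟩` has signature `(1,1)` at `σ` iff `σ(a)` and `σ(b)` have the SAME sign, and is definite iff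
they differ — plan-4's (A) restated; which sign each corner's line has at which place is the face's seesaw datum
(`MuTable.SeesawDatum.a`, ROUTE.md v2.89 L95 «definite where `a₀, a₁` have the same sign»), not a consequence of
anything here.

AUTOMORPHIC SUBSPACES.  `IsAutomorphicSubspace W V`: a `ℂ`-subspace of functions on `G(𝔸_k)` that are
left-`G(k)`-invariant and right-translation stable; `HasNonzeroToricPeriod W μT DT χ V`: some `f ∈ V` has a non-zero
toric period `P_χ(f|_T)` (the DEFINED predicate «`P_χ ≠ 0` on `τ`»); with these, L4.3b′ («∃ τ″ ⊂ L²([U(U)]) with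
`P_{μ₁ μ̄₃}(τ″) ≠ 0` and …») is one `def` on the defined objects.

Nothing here says anything about the status of the Hodge conjecture for CM abelian varieties, which is NOT proved
(HC_CM is NOT proved by anyone in this repository).
-/

set_option autoImplicit false

noncomputable section

namespace Summit.Ventures.HodgeRepro.Tier4.Common

open Matrix

section Lines

variable (k : Type) [Field k]

/-- The quadratic data of `E′ = k(ω)` over `k`: `ω² = t ω − n`. -/
structure QuadData where
  /-- the trace `t = ω + c(ω)` -/
  t : k
  /-- the norm `n = ω c(ω)` -/
  n : k

variable {k} (q : QuadData k)

/-- The matrix of multiplication by `ω` in the basis `(1, ω)`: `ω · 1 = ω`, `ω · ω = −n · 1 + t · ω`. -/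
def omegaMat : Matrix (Fin 2) (Fin 2) k := !![0, -q.n; 1, q.t]

/-- The Gram matrix of the trace form of the hermitian line `⟨a⟩` in the basis `(1, ω)`. -/
def lineGram (a : k) : Matrix (Fin 2) (Fin 2) k := a • !![2, q.t; q.t, 2 * q.n]

/-- The line Gram matrix is symmetric. -/
theorem lineGram_transpose (a : k) : (lineGram q a)ᵀ = lineGram q a := by
  ext i j
  fin_cases i <;> fin_cases j <;> simp [lineGram]

/-- The identity `2 × 2` block. -/
def blk1 : Matrix (Fin 2) (Fin 2) k := 1

/-- Reindexing `Fin 2 ⊕ Fin 2 ≃ Fin 4` as an algebra equivalence of square matrices. -/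
def re4 : Matrix (Fin 2 ⊕ Fin 2) (Fin 2 ⊕ Fin 2) k ≃ₐ[k] Matrix (Fin 4) (Fin 4) k :=
  Matrix.reindexAlgEquiv k k finSumFinEquiv

/-- A block-diagonal `4 × 4` matrix from two `2 × 2` blocks. -/
def blockDiag4 (A D : Matrix (Fin 2) (Fin 2) k) : Matrix (Fin 4) (Fin 4) k := re4 (fromBlocks A 0 0 D)

/-- Products of block-diagonal matrices are block-diagonal. -/
theorem blockDiag4_mul (A D A' D' : Matrix (Fin 2) (Fin 2) k) :
    blockDiag4 A D * blockDiag4 A' D' = blockDiag4 (A * A') (D * D') := by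
  simp only [blockDiag4, ← map_mul, fromBlocks_multiply, Matrix.mul_zero, Matrix.zero_mul, add_zero, zero_add]

/-- Sums of block-diagonal matrices are block-diagonal. -/
theorem blockDiag4_add (A D A' D' : Matrix (Fin 2) (Fin 2) k) :
    blockDiag4 A D + blockDiag4 A' D' = blockDiag4 (A + A') (D + D') := by
  simp only [blockDiag4, ← map_add, fromBlocks_add, add_zero]

/-- The block-diagonal matrix with identity blocks is the identity. -/
theorem blockDiag4_one : blockDiag4 (1 : Matrix (Fin 2) (Fin 2) k) 1 = 1 := by
  simp only [blockDiag4, fromBlocks_one, map_one]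

/-- The transpose of a block-diagonal matrix. -/
theorem blockDiag4_transpose (A D : Matrix (Fin 2) (Fin 2) k) : (blockDiag4 A D)ᵀ = blockDiag4 Aᵀ Dᵀ := by
  simp only [blockDiag4, re4, coe_reindexAlgEquiv, transpose_reindex, fromBlocks_transpose, transpose_zero]

/-- **The plane `⟨a⟩ ⊕ ⟨ε b⟩` as `PlaneData`** (`ε = 1`: the seesaw plane `W_a ⊕ W_b`; `ε = −1`: the mixed plane
`W_a ⊕ W_b⁻`), with the torus `U(⟨a⟩) × U(⟨ε b⟩)` as BOTH tori (`Q := P`). -/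
def PlaneData.ofLines (a b ε : k) : PlaneData k where
  B := blockDiag4 (lineGram q a) (ε • lineGram q b)
  Ω := blockDiag4 (omegaMat q) (omegaMat q)
  P := ![blockDiag4 1 0, blockDiag4 0 1]
  Q := ![blockDiag4 1 0, blockDiag4 0 1]
  B_symm := by
    rw [blockDiag4_transpose, lineGram_transpose, transpose_smul, lineGram_transpose]
  P_comm := by
    intro i
    fin_cases i <;> simp [blockDiag4_mul]
  Q_comm := by
    intro i
    fin_cases i <;> simp [blockDiag4_mul]
  P_idem := by
    intro i
    fin_cases i <;> simp [blockDiag4_mul]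
  Q_idem := by
    intro i
    fin_cases i <;> simp [blockDiag4_mul]
  P_sum := by
    show blockDiag4 1 0 + blockDiag4 0 1 = 1
    rw [blockDiag4_add, add_zero, zero_add, blockDiag4_one]
  Q_sum := by
    show blockDiag4 1 0 + blockDiag4 0 1 = 1
    rw [blockDiag4_add, add_zero, zero_add, blockDiag4_one]

/-- The seesaw plane `W_a ⊕ W_b`. -/
def PlaneData.seesaw (a b : k) : PlaneData k := PlaneData.ofLines q a b 1

/-- **The mixed plane `W_a ⊕ W_b⁻`** of line L4. -/
def PlaneData.mixed (a b : k) : PlaneData k := PlaneData.ofLines q a b (-1)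

end Lines

section Automorphic

open MeasureTheory

variable {k : Type} [Field k] [NumberField k] (W : PlaneData k)

/-- **An automorphic subspace** of functions on `G(𝔸_k)`: left-invariant under the rational points and stable under
right translation (the shape of an automorphic representation `τ ⊂ L²([G])` seen through its functions). -/
def IsAutomorphicSubspace (V : Submodule ℂ (GA W → ℂ)) : Prop :=
  (∀ f ∈ V, ∀ (γ : GA W), γ ∈ rationalPoints W → ∀ x, f (γ * x) = f x) ∧
    (∀ f ∈ V, ∀ g : GA W, (fun x => f (x * g)) ∈ V)

/-- The restriction of a function on `G(𝔸_k)` to a subgroup `S`. -/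
def restrictTo (S : Subgroup (GA W)) (f : GA W → ℂ) : S → ℂ := fun t => f (t : GA W)

/-- **`P_χ ≠ 0` on `V`**: some `f ∈ V` has a non-zero toric period against `χ` over the fundamental domain `D` of the
torus `S` (the DEFINED predicate «the toric period does not vanish on the representation»). -/
def HasNonzeroToricPeriod {S : Subgroup (GA W)} [MeasurableSpace S] (μS : Measure S) (D : Set S) (χ : S → ℂ)
    (V : Submodule ℂ (GA W → ℂ)) : Prop :=
  ∃ f ∈ V, periodLin W μS D χ (restrictTo W S f) ≠ 0

/-- The pointwise product of two characters (the mixed character `μ₁ μ̄₃`, given the two as functions). -/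
def mulChar {S : Subgroup (GA W)} (χ χ' : S → ℂ) : S → ℂ := fun t => χ t * χ' t

/-- The conjugate of a character. -/
def conjChar {S : Subgroup (GA W)} (χ : S → ℂ) : S → ℂ := fun t => starRingEnd ℂ (χ t)

end Automorphic

end Summit.Ventures.HodgeRepro.Tier4.Common

end
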